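import Literature.Computability.Cryptography.WordRAMFisherYates
import Mathlib.Tactic.IntervalCases
import Literature.Computability.Cryptography.WordRAMContractLevels
import Literature.Computability.Cryptography.WordRAMPrattFill
import Literature.Computability.Cryptography.WordRAMTripleSum
import Mathlib.Algebra.Order.BigOperators.Group.Finset
import HarnessLib

/-!
# The word RAM — one repetition of Pratt's balanced-tripartitioning test (plumbing of the verified parts)

One repetition of the randomised test of K. Pratt, STOC 2024, proof of Thm. 1.9 (fifteenth instalment of
the proof of `Literature.Computability.AlgebraicComplexity.pratt2024_thm_1_9`), assembled from the
verified parts of the tree: the shuffle `SProg.fisherYatesProg` (`WordRAMFisherYates`), the bit table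
and pattern masks (`WordRAMPatternTables.pow2Loop`, `tabProd`), the fill of the three input vectors
(`WordRAMPrattFill.fillProg`), the level tables of the bilinear algorithm for the three legs
(`WordRAMContractLevels.dpProg`) and the final trilinear sum with the answer flag
(`WordRAMTripleSum.tripleProg`).

* Part I — `sum_range_two_pow`, `permSum_eq`, `subsum_perm_pow_two_lt`, `sum_blocks_subsum_lt`: for a
  permutation `g` of `[M]`, `∑_{p<M} 2^{g p} = 2^M - 1`, so every `0/1`-subsum of these powers, and
  every sum of such subsums over disjoint blocks, is `< 2^M` — pattern masks and set masks are words
  as soon as `M = 3n ≤ w`; `RepTables`, `RepLayout` — the constant tables and the addresses.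
* Part II — the parts as plain-memory step lemmas: `SProg.fisherYates_plain` (the shuffle),
  `SProg.tables_step` (bit table and pattern masks `ptOf`), `SProg.fill_step` (the three vectors,
  values `xOf`), `SProg.dp_step` (level `q` of one leg, `levN`, with `levN_congr`), and the assembled
  `SProg.repBody` with `SProg.repBody_spec`: from the global registers `RepRegs`, a layout `RepSide`,
  the constant tables `RepData` and the coin words at `cp`, one repetition ends within `repTime`
  steps with the flag `81` or-ed with `[repV ≠ 0]`, where `SProg.repV` is the pure value of the
  repetition (triple sum modulo `2^w` of the three level-`q` tables of the fill values of the
  permutation `gOf M c = fisherYates M c`), the coin pointer advanced by `coins = (M-1) + 3 N^q`, and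
  all global registers and read-only data unchanged.

## References

* K. Pratt, *A stronger connection between the asymptotic rank conjecture and the set cover
  conjecture*, STOC 2024, arXiv:2311.02774, §2 (proof of Thm. 1.9).
-/

namespace Literature.Computability.Cryptography.WordRAM

open Finset Literature.Computability.AlgebraicComplexity

open scoped BigOperators

/-! ## Sums of distinct powers of two -/

/-- `∑_{e<M} 2^e = 2^M - 1`. [folklore] -/
theorem sum_range_two_pow (M : ℕ) : ∑ e ∈ range M, 2 ^ e = 2 ^ M - 1 := by
  induction M with
  | zero => simp
  | succ M ih => rw [sum_range_succ, ih, pow_succ]; have := Nat.one_le_two_pow (n := M); omega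

/-- For an injective `g` on `[M]` with values in `[M]`, `∑_{p<M} 2^{g p} = 2^M - 1`. [folklore] -/
theorem permSum_eq {M : ℕ} {g : ℕ → ℕ} (hg : ∀ p, p < M → g p < M)
    (hinj : ∀ p p', p < M → p' < M → g p = g p' → p = p') :
    ∑ p ∈ range M, 2 ^ g p = 2 ^ M - 1 := by
  rw [← sum_range_two_pow]
  refine sum_nbij g (fun p hp => mem_range.2 (hg p (mem_range.1 hp))) ?_ ?_ (fun _ _ => rfl)
  · intro p hp p' hp' h
    exact hinj p p' (mem_range.1 (mem_coe.1 hp)) (mem_range.1 (mem_coe.1 hp')) h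
  · -- surjective onto `[M]` by counting
    have hcard : ((range M).image g).card = M := by
      rw [card_image_of_injOn (fun p hp p' hp' h => hinj p p' (mem_range.1 (mem_coe.1 hp))
        (mem_range.1 (mem_coe.1 hp')) h), card_range]
    have hsub : (range M).image g ⊆ range M := fun e he => by
      obtain ⟨p, hp, rfl⟩ := mem_image.1 he; exact mem_range.2 (hg p (mem_range.1 hp))
    have heq : (range M).image g = range M := eq_of_subset_of_card_le hsub (by rw [hcard, card_range])
    intro e he
    have : e ∈ (range M).image g := by rw [heq]; exact he
    obtain ⟨p, hp, rfl⟩ := mem_image.1 this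
    exact ⟨p, mem_coe.2 hp, rfl⟩

/-- A `0/1`-weighted subsum of `2^{g p}` over an arithmetic block `[a, a + t) ⊆ [M]` is `< 2^M`.
[folklore] -/
theorem subsum_perm_pow_two_lt {M : ℕ} {g : ℕ → ℕ} (hg : ∀ p, p < M → g p < M)
    (hinj : ∀ p p', p < M → p' < M → g p = g p' → p = p') {a t : ℕ} (hat : a + t ≤ M)
    (b : ℕ → ℕ) (hb : ∀ i, i < t → b i ≤ 1) :
    ∑ i ∈ range t, b i * 2 ^ g (a + i) < 2 ^ M := by
  have h1 : ∑ i ∈ range t, b i * 2 ^ g (a + i) ≤ ∑ i ∈ range t, 2 ^ g (a + i) :=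
    sum_le_sum fun i hi => by
      have := hb i (mem_range.1 hi)
      calc b i * 2 ^ g (a + i) ≤ 1 * 2 ^ g (a + i) := Nat.mul_le_mul_right _ this
        _ = _ := one_mul _
  have h2 : ∑ i ∈ range t, 2 ^ g (a + i) ≤ ∑ p ∈ range M, 2 ^ g p := by
    rw [show ∑ i ∈ range t, 2 ^ g (a + i) = ∑ p ∈ (range t).map (addLeftEmbedding a), 2 ^ g p by
      rw [sum_map]; rfl]
    exact sum_le_sum_of_subset fun p hp => by
      obtain ⟨i, hi, rfl⟩ := mem_map.1 hp
      simp only [addLeftEmbedding_apply]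
      exact mem_range.2 (by have := mem_range.1 hi; omega)
  have h3 := permSum_eq hg hinj
  have h4 := Nat.one_le_two_pow (n := M)
  omega

/-- The full block sum `∑_{p < r·tk} 2^{g p}` split into blocks equals the range sum, hence any sum of
per-block `0/1`-subsums is `< 2^M` (`r · tk ≤ M`). [folklore] -/
theorem sum_blocks_subsum_lt {M r tk : ℕ} {g : ℕ → ℕ} (hg : ∀ p, p < M → g p < M)
    (hinj : ∀ p p', p < M → p' < M → g p = g p' → p = p') (hrt : r * tk ≤ M)
    (f : ℕ → ℕ) (hf : ∀ u, u < r → f u ≤ ∑ i ∈ range tk, 2 ^ g (u * tk + i)) :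
    ∑ u ∈ range r, f u < 2 ^ M := by
  have h1 : ∑ u ∈ range r, f u ≤ ∑ u ∈ range r, ∑ i ∈ range tk, 2 ^ g (u * tk + i) :=
    sum_le_sum fun u hu => hf u (mem_range.1 hu)
  have h2 : ∑ u ∈ range r, ∑ i ∈ range tk, 2 ^ g (u * tk + i) = ∑ p ∈ range (r * tk), 2 ^ g p := by
    rw [sum_range_mul_eq r tk (fun p => 2 ^ g p), sum_comm]
  have h3 : ∑ p ∈ range (r * tk), 2 ^ g p ≤ ∑ p ∈ range M, 2 ^ g p :=
    sum_le_sum_of_subset (range_subset_range.2 hrt)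
  have h4 := permSum_eq hg hinj
  have h5 := Nat.one_le_two_pow (n := M)
  omega

/-! ## The layout of one repetition -/

/-- The static tables of the algorithm as pure functions: block-membership bits `BM j i`
(`j < C`, `i < 3k`), membership tables `Ft l a` (`l < 3`, `a < MB`), coefficient tables `Uc l i d`.
[folklore] -/
structure RepTables where
  /-- `BM j i = 1` iff `i` lies in the `j`-th `k`-subset of `[3k]`. -/
  BM : ℕ → ℕ → ℕ
  /-- `Ft l a = 1` iff `a` is the mask of a (padded) set of family `l`. -/
  Ft : ℕ → ℕ → ℕ
  /-- The three integer coefficient tables, as words. -/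
  Uc : ℕ → ℕ → ℕ → ℕ

/-- The addresses and sizes of one repetition. [folklore] -/
structure RepLayout where
  /-- `3n`, the size of the universe (and of the permutation array). -/
  M : ℕ
  /-- `3k`, positions per block. -/
  tk : ℕ
  /-- `binom(3k,k)`, patterns per block. -/
  C : ℕ
  /-- Number of blocks `r` (`r · tk = M`). -/
  r : ℕ
  /-- `N = C^m`, the base of the level tables. -/
  N : ℕ
  /-- `R`, the number of triads. -/
  R : ℕ
  /-- `q`, the number of levels (`N^q = C^r`). -/
  q : ℕ
  /-- Base of the permutation array. -/
  pa : ℕ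
  /-- Base of the bit table `PB`. -/
  pb : ℕ
  /-- Base of the block-membership table `BM`. -/
  bm : ℕ
  /-- Base of the pattern-mask table `PT`. -/
  pt : ℕ
  /-- Bases of the three membership tables. -/
  FT : ℕ → ℕ
  /-- Size of a membership table (`2^M`). -/
  MB : ℕ
  /-- Bases of the three level regions (level `0` = the filled vector). -/
  X : ℕ → ℕ
  /-- Bases of the three coefficient tables. -/
  rU : ℕ → ℕ

namespace RepLayout

/-- Number of flat indices `C^r = N^q`. [folklore] -/
def Ntot (L : RepLayout) : ℕ := L.N ^ L.q

/-- Size of one level region. [folklore] -/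
def dsz (L : RepLayout) : ℕ := SProg.dpSize L.R L.N L.q

/-- Number of coin words one repetition consumes: `M - 1` for the shuffle, `3 Ntot` values. [folklore] -/
def coins (L : RepLayout) : ℕ := (L.M - 1) + 3 * L.Ntot

end RepLayout

/-! ## Part II — the parts as plain-memory step lemmas -/

namespace SProg

open StateTransition Literature.Combinatorics.Enumerative

variable {w : ℕ} {O : List ℕ → List ℕ}

/-- **The shuffle, plain-memory form** of `fisherYatesProg_achieves` (`WordRAMFisherYates`): array
base `A` in `15`, `N ≥ 1` in `6`, coin pointer `C` in `40`; afterwards `[A, A+N)` holds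
`fisherYates N c`, `40` holds `C + (N - 1)`, and nothing else changed outside `40–47` and the array.
[cite: KnuthTAOCP2, §3.4.2 Algorithm P] -/
theorem fisherYates_plain {m : ℕ → ℕ} {A N C : ℕ} (c : ℕ → ℕ) (h15 : m 15 = A) (h6 : m 6 = N)
    (h40 : m 40 = C) (hA : 100 ≤ A) (hC : 100 ≤ C) (hN : 1 ≤ N) (hdisj : A + N ≤ C ∨ C + (N - 1) ≤ A)
    (hAw : A + N < 2 ^ w) (hCw : C + N < 2 ^ w)
    (hcoin : ∀ t, t < N - 1 → m (C + t) = c t ∧ c t < 2 ^ w) (qs : List (List ℕ)) :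
    ∃ st', ExecLE w O fisherYatesProg ⟨m, qs⟩ st' (20 * N + 8) ∧ st'.queries = qs ∧
      st'.mem 40 = C + (N - 1) ∧
      (∀ x (hx : x < N), st'.mem (A + x) = ((fisherYates N c ⟨x, hx⟩ : Fin N) : ℕ)) ∧
      (∀ a, ¬ (40 ≤ a ∧ a ≤ 47) → ¬ (A ≤ a ∧ a < A + N) → st'.mem a = m a) := by
  have hach := fisherYatesProg_achieves (w := w) (O := O) (R := m) (H := m) c h15 h6 h40 hA hC hN hdisj
    hAw hCw hcoin
  obtain ⟨mem', t, ht, hex, R', H', hm', h40', hR', hH', hH''⟩ := hach qs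
  rw [merge_self] at hex
  refine ⟨⟨mem', qs⟩, ⟨t, ht, hex⟩, rfl, ?_, fun x hx => ?_, fun a ha hna => ?_⟩
  · show mem' 40 = _; rw [hm', merge_apply_of_lt (by norm_num)]; exact h40'
  · show mem' (A + x) = _; rw [hm', merge_apply_of_le (by omega)]; exact hH' x hx
  · show mem' a = m a
    rw [hm']
    by_cases h100 : a < 100
    · rw [merge_apply_of_lt h100]; exact hR' a (by unfold fyScratch; omega)
    · rw [merge_apply_of_le (by omega)]; exact hH'' a (by omega)

/-- The pattern mask `PT[u][j] = ∑_{i<3k} BM[j][i] · 2^{g(3k u + i)}` of a permutation `g`. [cite: Pratt2024SCC, §2 (proof of Thm. 1.9)] -/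
def ptOf (BM : ℕ → ℕ → ℕ) (g : ℕ → ℕ) (tk u j : ℕ) : ℕ := ∑ i ∈ range tk, BM j i * 2 ^ g (u * tk + i)

/-- **Bit table and pattern masks** (`pow2Loop` then `tabProd`): with the permutation array `g`
(a permutation of `[M]`, `M ≤ w`) at `pa` and the `0/1` block-membership table at `bm`, afterwards
`PT[u][j] = ptOf BM g tk u j` at `pt + u C + j` for `u < r`, `j < C`; every such mask is `< 2^M`;
nothing changed outside `82–91`, `[pb, pb+M)` and `[pt, pt + r C)`. [cite: Pratt2024SCC, §2 (proof of Thm. 1.9)] -/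
theorem tables_step {m : ℕ → ℕ} {pa pb bm pt tk C r M : ℕ} {g : ℕ → ℕ} {BM : ℕ → ℕ → ℕ}
    (h30 : m 30 = pa) (h31 : m 31 = pb) (h32 : m 32 = bm) (h33 : m 33 = pt) (h34 : m 34 = tk)
    (h35 : m 35 = C) (h36 : m 36 = r) (h37 : m 37 = M)
    (hpa : 100 ≤ pa) (hpb : 100 ≤ pb) (hbm : 100 ≤ bm) (hpt : 100 ≤ pt)
    (hpaE : pa + M < 2 ^ w) (hpbE : pb + M < 2 ^ w) (hbmE : bm + C * tk < 2 ^ w) (hptE : pt + r * C < 2 ^ w)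
    (htk : tk < 2 ^ w) (hC : C < 2 ^ w) (hr : r < 2 ^ w) (hMw : M ≤ w) (hrtk : r * tk = M)
    (hpa_pb : pa + M ≤ pb ∨ pb + M ≤ pa) (hpt_pb : pt + r * C ≤ pb ∨ pb + M ≤ pt)
    (hpt_bm : pt + r * C ≤ bm ∨ bm + C * tk ≤ pt) (hbm_pb : pb + M ≤ bm ∨ bm + C * tk ≤ pb)
    (hg : ∀ p, p < M → m (pa + p) = g p) (hgM : ∀ p, p < M → g p < M)
    (hginj : ∀ p p', p < M → p' < M → g p = g p' → p = p')
    (hBM : ∀ j i, j < C → i < tk → m (bm + j * tk + i) = BM j i) (hBM1 : ∀ j i, j < C → i < tk → BM j i ≤ 1)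
    (qs : List (List ℕ)) :
    ∃ st', ExecLE w O (seq pow2Loop tabProd) ⟨m, qs⟩ st' (M * 8 + 4 + (r * (C * (tk * 8 + 12) + 7) + 4)) ∧
      st'.queries = qs ∧
      (∀ u j, u < r → j < C → st'.mem (pt + u * C + j) = ptOf BM g tk u j) ∧
      (∀ u j, u < r → j < C → ptOf BM g tk u j < 2 ^ M) ∧
      (∀ p, p < M → st'.mem (pb + p) = 2 ^ g p) ∧
      (∀ c, ¬ (82 ≤ c ∧ c ≤ 91) → ¬ (pb ≤ c ∧ c < pb + M) → ¬ (pt ≤ c ∧ c < pt + r * C) → st'.mem c = m c) := by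
  -- the bit table
  obtain ⟨st₁, hex₁, hP⟩ := pow2Loop_spec (w := w) (O := O) h30 h31 h37 hpa hpb hpaE hpbE hpa_pb
    (fun p hp => by rw [hg p hp]; exact lt_of_lt_of_le (hgM p hp) hMw) qs
  obtain ⟨hq₁, _, _, _, _, _, _, gwr, gfr⟩ := hP
  obtain ⟨mm₁, qq₁⟩ := st₁
  simp only at hq₁ gwr gfr
  subst qq₁
  have hPB : ∀ p, p < M → mm₁ (pb + p) = 2 ^ g p := fun p hp => by rw [gwr p hp, hg p hp]
  have hkeep₁ : ∀ c, ¬ (82 ≤ c ∧ c ≤ 85) → ¬ (pb ≤ c ∧ c < pb + M) → mm₁ c = m c := fun c hc hnc =>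
    gfr c (by omega) (by omega) (by omega) (by omega) hnc
  have hBM₁ : ∀ j i, j < C → i < tk → mm₁ (bm + j * tk + i) = BM j i := fun j i hj hi => by
    have hjt : j * tk + tk ≤ C * tk := by
      have := Nat.mul_le_mul_right tk hj; rw [Nat.succ_mul] at this; exact this
    rw [hkeep₁ _ (by omega) (by rcases hbm_pb with hh | hh <;> omega)]; exact hBM j i hj hi
  have hbound : ∀ u j, u < r → j < C → ptOf BM g tk u j < 2 ^ M := fun u j hu hj => by
    have hut : u * tk + tk ≤ M := by
      have := Nat.mul_le_mul_right tk hu; rw [Nat.succ_mul] at this; omega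
    exact subsum_perm_pow_two_lt hgM hginj hut (fun i => BM j i) (fun i hi => hBM1 j i hj hi)
  have hMw' : 2 ^ M ≤ 2 ^ w := Nat.pow_le_pow_right (by norm_num) hMw
  -- the pattern masks
  have hval : ∀ u j, u < r → j < C → ptVal mm₁ bm (pb + u * tk) tk j = ptOf BM g tk u j := by
    intro u j hu hj
    unfold ptVal ptOf
    refine sum_congr rfl fun i hi => ?_
    rw [mem_range] at hi
    have hut : u * tk + tk ≤ M := by
      have := Nat.mul_le_mul_right tk hu; rw [Nat.succ_mul] at this; omega
    rw [hBM₁ j i hj hi, show pb + u * tk + i = pb + (u * tk + i) by omega, hPB _ (by omega)]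
  have hTS : TSide w mm₁ pb bm pt tk C r := by
    refine ⟨hpb, hbm, hpt, by rw [hrtk]; exact hpbE, hbmE, hptE, htk, hC, hr, ?_, hpt_bm,
      fun j i hj hi => by rw [hBM₁ j i hj hi]; exact hBM1 j i hj hi, fun u i hu hi => ?_,
      fun u j hu hj => by rw [hval u j hu hj]; exact lt_of_lt_of_le (hbound u j hu hj) hMw'⟩
    · rw [hrtk]; exact hpt_pb
    · have hut : u * tk + tk ≤ M := by
        have := Nat.mul_le_mul_right tk hu; rw [Nat.succ_mul] at this; omega
      rw [show pb + u * tk + i = pb + (u * tk + i) by omega, hPB _ (by omega)]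
      exact lt_of_lt_of_le (Nat.pow_lt_pow_right (by norm_num) (hgM _ (by omega))) hMw'
  obtain ⟨st₂, hex₂, hT⟩ := tabProd_spec (w := w) (O := O) hTS
    (by rw [hkeep₁ 31 (by omega) (by omega)]; exact h31) (by rw [hkeep₁ 32 (by omega) (by omega)]; exact h32)
    (by rw [hkeep₁ 33 (by omega) (by omega)]; exact h33) (by rw [hkeep₁ 34 (by omega) (by omega)]; exact h34)
    (by rw [hkeep₁ 35 (by omega) (by omega)]; exact h35) (by rw [hkeep₁ 36 (by omega) (by omega)]; exact h36) qs
  obtain ⟨hq₂, _, _, _, _, _, _, _, _, _, kwr, kfr⟩ := hT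
  refine ⟨st₂, hex₁.seq hex₂, hq₂, fun u j hu hj => ?_, hbound, fun p hp => ?_, fun c hc hpb' hpt' => ?_⟩
  · rw [kwr u j hu hj, hval u j hu hj]
  · rw [kfr _ (by omega) (by rcases hpt_pb with hh | hh <;> omega)]; exact hPB p hp
  · rw [kfr c hc hpt']; exact hkeep₁ c (by omega) hpb'

/-- A pattern mask is at most the sum of the bits of its block. [folklore] -/
theorem ptOf_le {BM : ℕ → ℕ → ℕ} (g : ℕ → ℕ) (tk u j : ℕ) (hBM1 : ∀ i, i < tk → BM j i ≤ 1) :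
    ptOf BM g tk u j ≤ ∑ i ∈ range tk, 2 ^ g (u * tk + i) :=
  sum_le_sum fun i hi => by
    have := hBM1 i (mem_range.1 hi)
    calc BM j i * 2 ^ g (u * tk + i) ≤ 1 * 2 ^ g (u * tk + i) := Nat.mul_le_mul_right _ this
      _ = _ := one_mul _

/-- The mask of a flat index: the sum of the pattern masks of its digits. [cite: Pratt2024SCC, §2 (proof of Thm. 1.9)] -/
def maskOf (BM : ℕ → ℕ → ℕ) (g : ℕ → ℕ) (tk C r idx : ℕ) : ℕ :=
  ∑ u ∈ range r, ptOf BM g tk u (digit C u idx)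

/-- Masks are words: `maskOf < 2^M` for a permutation `g` of `[M]`, `r · tk = M`. [folklore] -/
theorem maskOf_lt {BM : ℕ → ℕ → ℕ} {g : ℕ → ℕ} {tk C r M : ℕ} (hgM : ∀ p, p < M → g p < M)
    (hginj : ∀ p p', p < M → p' < M → g p = g p' → p = p') (hrtk : r * tk = M) (hC : 0 < C)
    (hBM1 : ∀ j i, j < C → i < tk → BM j i ≤ 1) (idx : ℕ) : maskOf BM g tk C r idx < 2 ^ M :=
  sum_blocks_subsum_lt hgM hginj hrtk.le _ fun u _ =>
    ptOf_le g tk u _ fun i hi => hBM1 _ i (digit_lt hC u idx) hi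

/-- The value written for leg `l` at flat index `idx`: membership bit of the mask times a 4-bit coin.
[cite: Pratt2024SCC, §2 (proof of Thm. 1.9)] -/
def xOf (T : RepTables) (g : ℕ → ℕ) (Lay : RepLayout) (v : ℕ → ℕ) (l idx : ℕ) : ℕ :=
  T.Ft l (maskOf T.BM g Lay.tk Lay.C Lay.r idx) * (v (3 * idx + l) % 16)

/-- **The fill step**: with the pattern masks of `g` in place, the membership tables `Ft` (entries
`≤ 1`) at `FT l`, coins `v` at `cp`, afterwards `X_l[idx] = xOf … l idx` for `l < 3`, `idx < Ntot`,
the coin pointer is `cp + 3 Ntot`, and nothing changed outside `80`, `82–94` and the three vectors.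
[cite: Pratt2024SCC, §2 (proof of Thm. 1.9)] -/
theorem fill_step {m : ℕ → ℕ} {T : RepTables} {Lay : RepLayout} {g v : ℕ → ℕ} {M cp : ℕ}
    (h33 : m 33 = Lay.pt) (h35 : m 35 = Lay.C) (h36 : m 36 = Lay.r) (h38 : m 38 = Lay.Ntot)
    (h39 : m 39 = Lay.FT 0) (h40 : m 40 = Lay.FT 1) (h41 : m 41 = Lay.FT 2) (h42 : m 42 = Lay.X 0)
    (h43 : m 43 = Lay.X 1) (h44 : m 44 = Lay.X 2) (h80 : m 80 = cp)
    (hpt : 100 ≤ Lay.pt) (hC : 1 ≤ Lay.C) (hptE : Lay.pt + Lay.r * Lay.C < 2 ^ w) (hNtot : Lay.Ntot < 2 ^ w)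
    (hFT : ∀ l, l < 3 → 100 ≤ Lay.FT l ∧ Lay.FT l + Lay.MB < 2 ^ w)
    (hX : ∀ l, l < 3 → 100 ≤ Lay.X l ∧ Lay.X l + Lay.Ntot < 2 ^ w)
    (hcp : 100 ≤ cp) (hcpE : cp + 3 * Lay.Ntot < 2 ^ w) (hw : 4 ≤ w)
    (hX_pt : ∀ l, l < 3 → Lay.X l + Lay.Ntot ≤ Lay.pt ∨ Lay.pt + Lay.r * Lay.C ≤ Lay.X l)
    (hX_FT : ∀ l l', l < 3 → l' < 3 → Lay.X l + Lay.Ntot ≤ Lay.FT l' ∨ Lay.FT l' + Lay.MB ≤ Lay.X l)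
    (hX_cp : ∀ l, l < 3 → Lay.X l + Lay.Ntot ≤ cp ∨ cp + 3 * Lay.Ntot ≤ Lay.X l)
    (hX_X : ∀ l l', l < 3 → l' < 3 → l ≠ l' → Lay.X l + Lay.Ntot ≤ Lay.X l' ∨ Lay.X l' + Lay.Ntot ≤ Lay.X l)
    (hMB : Lay.MB = 2 ^ M) (hgM : ∀ p, p < M → g p < M)
    (hginj : ∀ p p', p < M → p' < M → g p = g p' → p = p') (hrtk : Lay.r * Lay.tk = M)
    (hBM1 : ∀ j i, j < Lay.C → i < Lay.tk → T.BM j i ≤ 1)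
    (hPT : ∀ u j, u < Lay.r → j < Lay.C → m (Lay.pt + u * Lay.C + j) = ptOf T.BM g Lay.tk u j)
    (hFt : ∀ l a, l < 3 → a < Lay.MB → m (Lay.FT l + a) = T.Ft l a) (hFt1 : ∀ l a, l < 3 → a < Lay.MB → T.Ft l a ≤ 1)
    (hv : ∀ t, t < 3 * Lay.Ntot → m (cp + t) = v t ∧ v t < 2 ^ w) (qs : List (List ℕ)) :
    ∃ st', ExecLE w O fillProg ⟨m, qs⟩ st' (Lay.Ntot * (Lay.r * 8 + 33) + 6) ∧ st'.queries = qs ∧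
      st'.mem 80 = cp + 3 * Lay.Ntot ∧
      (∀ l i, l < 3 → i < Lay.Ntot → st'.mem (Lay.X l + i) = xOf T g Lay v l i) ∧
      (∀ c, c ≠ 80 → ¬ (82 ≤ c ∧ c ≤ 94) → ¬ (Lay.X 0 ≤ c ∧ c < Lay.X 0 + Lay.Ntot) →
        ¬ (Lay.X 1 ≤ c ∧ c < Lay.X 1 + Lay.Ntot) → ¬ (Lay.X 2 ≤ c ∧ c < Lay.X 2 + Lay.Ntot) → st'.mem c = m c) := by
  have hmaskeq : ∀ i, maskSum m Lay.pt Lay.C i Lay.r = maskOf T.BM g Lay.tk Lay.C Lay.r i := fun i => by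
    unfold maskSum maskOf
    exact sum_congr rfl fun u hu => hPT u _ (mem_range.1 hu) (digit_lt (by omega) u i)
  let FL : FillLayout := ⟨Lay.pt, Lay.C, Lay.r, Lay.Ntot, Lay.FT, Lay.MB, Lay.X, cp⟩
  have hFS : FillSide w m FL := by
    refine ⟨hpt, hC, hptE, hNtot, hFT, hX, hcp, hcpE, hw, hX_pt, hX_FT, hX_cp, hX_X, fun i _ => ?_,
      fun l a hl ha => ?_, fun t ht => ?_⟩
    · show maskSum m Lay.pt Lay.C i Lay.r < Lay.MB
      rw [hmaskeq, hMB]; exact maskOf_lt hgM hginj hrtk (by omega) hBM1 i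
    · show m (Lay.FT l + a) ≤ 1; rw [hFt l a hl ha]; exact hFt1 l a hl ha
    · show m (cp + t) < 2 ^ w; rw [(hv t ht).1]; exact (hv t ht).2
  obtain ⟨st', hex, hI⟩ := fillProg_spec (w := w) (O := O) hFS h33 h35 h36 h38 h39 h40 h41 h42 h43 h44 h80 qs
  refine ⟨st', hex, hI.queries, hI.r80, fun l i hl hi => ?_, hI.frame⟩
  rw [hI.written l i hl hi]
  show m (Lay.FT l + maskSum m Lay.pt Lay.C i Lay.r) * (m (cp + 3 * i + l) % 16) = _
  have hm : maskOf T.BM g Lay.tk Lay.C Lay.r i < Lay.MB := by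
    rw [hMB]; exact maskOf_lt hgM hginj hrtk (by omega) hBM1 i
  rw [hmaskeq, hFt l _ hl hm, show cp + 3 * i + l = cp + (3 * i + l) by omega, (hv _ (by omega)).1]
  rfl

/-! ### The level tables of one leg -/

/-- Setting up the level computation of leg `l`: `50 := rU_l; 55 := q; 56 := X_l; 57 := X_l + N^q;
58 := R; 59 := N^{q-1}` from the globals `12+l, 5, 16+l, 8, 7, 9`. [folklore] -/
def dpSet (l : ℕ) : List OpSpec :=
  [(.add, .dir 50, .dir (12 + l), .imm 0), (.add, .dir 55, .dir 5, .imm 0),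
    (.add, .dir 56, .dir (16 + l), .imm 0), (.add, .dir 57, .dir (16 + l), .dir 8),
    (.add, .dir 58, .dir 7, .imm 0), (.add, .dir 59, .dir 9, .imm 0)]

/-- `levN` depends only on the coefficient table on `[R] × [N]` and on the input on `[N^q]`. [folklore] -/
theorem levN_congr {N R q w : ℕ} {Uc Uc' : ℕ → ℕ → ℕ} {x x' : ℕ → ℕ} (hR : 1 ≤ R)
    (hU : ∀ i d, i < R → d < N → Uc i d = Uc' i d) (hx : ∀ A, A < N ^ q → x A = x' A) :
    ∀ j, j ≤ q → ∀ P A, A < N ^ (q - j) → levN N R q w Uc x j P A = levN N R q w Uc' x' j P A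
  | 0, _, P, A, hA => by simpa using hx A (by simpa using hA)
  | j + 1, hj, P, A, hA => by
    rw [levN_succ, levN_succ]
    congr 1
    refine sum_congr rfl fun d hd => ?_
    rw [mem_range] at hd
    rw [hU _ _ (Nat.mod_lt _ (by omega)) hd, levN_congr hR hU hx j (by omega) (P / R) _ ?_]
    calc d * N ^ (q - (j + 1)) + A < d * N ^ (q - (j + 1)) + N ^ (q - (j + 1)) := by omega
      _ = (d + 1) * N ^ (q - (j + 1)) := by ring
      _ ≤ N * N ^ (q - (j + 1)) := Nat.mul_le_mul_right _ hd
      _ = N ^ (q - j) := by rw [← pow_succ']; congr 1; omega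

set_option linter.unusedSimpArgs false in
/-- **The level step of leg `l`** (`dpSet l` then `dpProg`): afterwards level `q` of the region based
at `X` holds `levN … q P 0` for `P < R^q`, and nothing changed outside `50`, `55–72` and the levels
`1, …, q`. [cite: BurgisserClausenShokrollahi1997, Prop. 15.26] -/
theorem dp_step {m : ℕ → ℕ} {l rU X N R q : ℕ} (hl : l < 3) (h12 : m (12 + l) = rU) (h5 : m 5 = q)
    (h16 : m (16 + l) = X) (h8 : m 8 = N ^ q) (h7 : m 7 = R) (h9 : m 9 = N ^ (q - 1))
    (h52 : m 52 = N) (h53 : m 53 = R) (hS : LSide w m rU X N R q) (qs : List (List ℕ)) :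
    ∃ st', ExecLE w O (seq (block (dpSet l)) dpProg) ⟨m, qs⟩ st' (6 + dpTime N R q) ∧
      st'.queries = qs ∧
      (∀ P, P < R ^ q → st'.mem (levelBase X R N q q + P) =
        levN N R q w (fun i d => m (rU + i * N + d)) (fun A => m (X + A)) q P 0) ∧
      (∀ c, c ≠ 50 → ¬ (55 ≤ c ∧ c ≤ 72) → ¬ (X + N ^ q ≤ c ∧ c < X + dpSize R N q) →
        st'.mem c = m c) := by
  obtain ⟨hrU, hcoef, hN, hR, hfit, hcv, hxv⟩ := hS
  have htop := levelBase_top X R N q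
  have hqd := succ_le_dpSize hR hN q
  have hRN : R ≤ R * N := Nat.le_mul_of_pos_right _ (by omega)
  have hNq : N ^ (q - 1) ≤ N ^ q := Nat.pow_le_pow_right hN (by omega)
  have hNqd : N ^ q ≤ dpSize R N q := by
    have := pow_mul_pow_le_dpSize R N q (Nat.zero_le q); simpa using this
  have hlev1 : levelBase X R N q 1 = X + N ^ q := by
    rw [levelBase_succ, levelBase_zero, pow_zero, one_mul, Nat.sub_zero]
  have hrU2 : rU < 2 ^ w := by omega
  have hq2 : q < 2 ^ w := by omega
  have hX2 : X + N ^ q < 2 ^ w := by omega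
  have hR2 : R < 2 ^ w := by omega
  have hN2 : N ^ (q - 1) < 2 ^ w := by omega
  obtain ⟨st₁, hex₁, hP⟩ : ∃ st', Exec w O (block (dpSet l)) ⟨m, qs⟩ st' 6 ∧
      (st'.queries = qs ∧ st'.mem 50 = rU ∧ st'.mem 52 = N ∧ st'.mem 53 = R ∧ st'.mem 55 = q ∧
        st'.mem 56 = X ∧ st'.mem 57 = X + N ^ q ∧ st'.mem 58 = R ∧ st'.mem 59 = N ^ (q - 1) ∧
        ∀ c, c ≠ 50 → ¬ (55 ≤ c ∧ c ≤ 59) → st'.mem c = m c) := by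
    refine Exec.block_of_fwd (dpSet l) qs fun Rf hR => ?_
    unfold dpSet at hR
    have htmp := execOps_cons_fwd hR; clear hR; obtain ⟨v1, hv1, hR⟩ := htmp
    simp -failIfUnchanged (disch := omega) only [Operand.write, Operand.read,
      Function.update_self, Function.update_of_ne, BinOp.eval_add_mod', BinOp.eval_mul_mod',
      Nat.mod_eq_of_lt, BinOp.eval_sub_of_le, BinOp.eval_lt, Nat.add_zero, h12] at hv1 hR
    subst v1
    have htmp := execOps_cons_fwd hR; clear hR; obtain ⟨v2, hv2, hR⟩ := htmp
    simp -failIfUnchanged (disch := omega) only [Operand.write, Operand.read,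
      Function.update_self, Function.update_of_ne, BinOp.eval_add_mod', BinOp.eval_mul_mod',
      Nat.mod_eq_of_lt, BinOp.eval_sub_of_le, BinOp.eval_lt, Nat.add_zero, h5] at hv2 hR
    subst v2
    have htmp := execOps_cons_fwd hR; clear hR; obtain ⟨v3, hv3, hR⟩ := htmp
    simp -failIfUnchanged (disch := omega) only [Operand.write, Operand.read,
      Function.update_self, Function.update_of_ne, BinOp.eval_add_mod', BinOp.eval_mul_mod',
      Nat.mod_eq_of_lt, BinOp.eval_sub_of_le, BinOp.eval_lt, Nat.add_zero, h16] at hv3 hR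
    subst v3
    have htmp := execOps_cons_fwd hR; clear hR; obtain ⟨v4, hv4, hR⟩ := htmp
    simp -failIfUnchanged (disch := omega) only [Operand.write, Operand.read,
      Function.update_self, Function.update_of_ne, BinOp.eval_add_mod', BinOp.eval_mul_mod',
      Nat.mod_eq_of_lt, BinOp.eval_sub_of_le, BinOp.eval_lt, Nat.add_zero, h16, h8] at hv4 hR
    subst v4
    have htmp := execOps_cons_fwd hR; clear hR; obtain ⟨v5, hv5, hR⟩ := htmp
    simp -failIfUnchanged (disch := omega) only [Operand.write, Operand.read,
      Function.update_self, Function.update_of_ne, BinOp.eval_add_mod', BinOp.eval_mul_mod',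
      Nat.mod_eq_of_lt, BinOp.eval_sub_of_le, BinOp.eval_lt, Nat.add_zero, h7] at hv5 hR
    subst v5
    have htmp := execOps_cons_fwd hR; clear hR; obtain ⟨v6, hv6, hR⟩ := htmp
    simp -failIfUnchanged (disch := omega) only [Operand.write, Operand.read,
      Function.update_self, Function.update_of_ne, BinOp.eval_add_mod', BinOp.eval_mul_mod',
      Nat.mod_eq_of_lt, BinOp.eval_sub_of_le, BinOp.eval_lt, Nat.add_zero, h9] at hv6 hR
    subst v6
    simp only [execOps_nil] at hR
    subst hR
    refine ⟨rfl, ?_, ?_, ?_, ?_, ?_, ?_, ?_, ?_, fun c hc hc' => ?_⟩ <;> dsimp only <;>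
      simp (disch := omega) only [Function.update_of_ne, Function.update_self, h52, h53]
  obtain ⟨hq₁, g50, g52, g53, g55, g56, g57, g58, g59, gfr⟩ := hP
  obtain ⟨mm, qq⟩ := st₁
  simp only at hq₁ g50 g52 g53 g55 g56 g57 g58 g59 gfr
  subst qq
  have hS' : LSide w mm rU X N R q :=
    ⟨hrU, hcoef, hN, hR, hfit, fun i d hi hd => by
        have : i * N + N ≤ R * N := by
          have := Nat.mul_le_mul_right N hi; rw [Nat.succ_mul] at this; exact this
        rw [gfr _ (by omega) (by omega)]; exact hcv i d hi hd,
      fun A hA => by rw [gfr _ (by omega) (by omega)]; exact hxv A hA⟩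
  obtain ⟨st₂, hex₂, hL⟩ := dpProg_spec (w := w) (O := O) hS' g50 g52 g53 g55 g56 g57 g58 g59 qs
  obtain ⟨hq₂, _, _, _, _, _, _, _, _, hdata, hfr₂⟩ := hL
  refine ⟨st₂, hex₁.execLE.seq hex₂, hq₂, fun P hP => ?_, fun c hc hc' hc'' => ?_⟩
  · have hd := hdata q le_rfl P 0 hP (by simp)
    rw [Nat.sub_self, pow_zero, mul_one, add_zero] at hd
    rw [hd]
    refine levN_congr hR (fun i d hi hd' => ?_) (fun A hA => ?_) q le_rfl P 0 (by simp)
    · have : i * N + N ≤ R * N := by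
        have := Nat.mul_le_mul_right N hi; rw [Nat.succ_mul] at this; exact this
      exact gfr _ (by omega) (by omega)
    · exact gfr _ (by omega) (by omega)
  · rw [hfr₂ c (by omega) (by rw [hlev1, htop]; exact hc''), gfr c hc (by omega)]

/-! ### One repetition -/

/-- The permutation array produced by the shuffle with coins `c`, as a function on `ℕ`. [folklore] -/
def gOf (M : ℕ) (c : ℕ → ℕ) (p : ℕ) : ℕ :=
  if h : p < M then ((Literature.Combinatorics.Enumerative.fisherYates M c ⟨p, h⟩ : Fin M) : ℕ) else 0

/-- `gOf` maps `[M]` into `[M]`. [folklore] -/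
theorem gOf_lt {M : ℕ} (c : ℕ → ℕ) {p : ℕ} (hp : p < M) : gOf M c p < M := by
  unfold gOf; rw [dif_pos hp]; exact Fin.is_lt _

/-- `gOf` is injective on `[M]`. [folklore] -/
theorem gOf_inj {M : ℕ} (c : ℕ → ℕ) {p p' : ℕ} (hp : p < M) (hp' : p' < M)
    (h : gOf M c p = gOf M c p') : p = p' := by
  unfold gOf at h
  rw [dif_pos hp, dif_pos hp'] at h
  have := (Literature.Combinatorics.Enumerative.fisherYates M c).injective (Fin.ext h)
  simpa using this

/-- Before the shuffle: the coin pointer goes to `40`. [folklore] -/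
def preFY : List OpSpec := [(.add, .dir 40, .dir 80, .imm 0)]

/-- After the shuffle: the advanced coin pointer back to `80`, and the registers `40–47` the shuffle
used are reloaded from their copies. [folklore] -/
def restore : List OpSpec :=
  [(.add, .dir 80, .dir 40, .imm 0), (.add, .dir 40, .dir 23, .imm 0), (.add, .dir 41, .dir 19, .imm 0),
    (.add, .dir 42, .dir 16, .imm 0), (.add, .dir 43, .dir 17, .imm 0), (.add, .dir 44, .dir 18, .imm 0),
    (.add, .dir 45, .dir 10, .imm 0), (.add, .dir 46, .dir 20, .imm 0), (.add, .dir 47, .dir 21, .imm 0)]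

/-- **One repetition** of Pratt's test: shuffle, bit and pattern tables, fill the three vectors,
three level computations, triple sum or-ed into the flag `81`. [cite: Pratt2024SCC, §2 (proof of Thm. 1.9)] -/
def repBody : SProg :=
  seqs [block preFY, fisherYatesProg, block restore, seq pow2Loop tabProd, fillProg,
    seq (block (dpSet 0)) dpProg, seq (block (dpSet 1)) dpProg, seq (block (dpSet 2)) dpProg, tripleProg]

/-- Base of level `q` (the output level) of leg `l`. [folklore] -/
def _root_.Literature.Computability.Cryptography.WordRAM.RepLayout.LB (Lay : RepLayout) (l : ℕ) : ℕ := levelBase (Lay.X l) Lay.R Lay.N Lay.q Lay.q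

/-- The global registers one repetition reads (all outside its clobber sets), the coin pointer `80`
and the flag `81`. [folklore] -/
structure RepRegs (m : ℕ → ℕ) (Lay : RepLayout) (cp found : ℕ) : Prop where
  r5 : m 5 = Lay.q
  r6 : m 6 = Lay.M
  r7 : m 7 = Lay.R
  r8 : m 8 = Lay.Ntot
  r9 : m 9 = Lay.N ^ (Lay.q - 1)
  r10 : m 10 = Lay.R ^ Lay.q
  r12 : m 12 = Lay.rU 0
  r13 : m 13 = Lay.rU 1
  r14 : m 14 = Lay.rU 2
  r15 : m 15 = Lay.pa
  r16 : m 16 = Lay.X 0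
  r17 : m 17 = Lay.X 1
  r18 : m 18 = Lay.X 2
  r19 : m 19 = Lay.FT 2
  r20 : m 20 = Lay.LB 0
  r21 : m 21 = Lay.LB 1
  r23 : m 23 = Lay.FT 1
  r30 : m 30 = Lay.pa
  r31 : m 31 = Lay.pb
  r32 : m 32 = Lay.bm
  r33 : m 33 = Lay.pt
  r34 : m 34 = Lay.tk
  r35 : m 35 = Lay.C
  r36 : m 36 = Lay.r
  r37 : m 37 = Lay.M
  r38 : m 38 = Lay.Ntot
  r39 : m 39 = Lay.FT 0
  r48 : m 48 = Lay.LB 2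
  r52 : m 52 = Lay.N
  r53 : m 53 = Lay.R
  r80 : m 80 = cp
  r81 : m 81 = found
  hfound : found ≤ 1

/-- The static layout of a run: the regions in increasing order `pa, pb, pt` (rewritten every
repetition), `bm, FT₀₋₂, rU₀₋₂` (read only), `X₀₋₂` (rewritten), then the coins from `cp0` on;
and the size constraints. [folklore] -/
structure RepSide (w : ℕ) (Lay : RepLayout) (cp0 : ℕ) : Prop where
  hpa : 100 ≤ Lay.pa
  c1 : Lay.pa + Lay.M ≤ Lay.pb
  c2 : Lay.pb + Lay.M ≤ Lay.pt
  c3 : Lay.pt + Lay.r * Lay.C ≤ Lay.bm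
  c4 : Lay.bm + Lay.C * Lay.tk ≤ Lay.FT 0
  c5 : Lay.FT 0 + Lay.MB ≤ Lay.FT 1
  c6 : Lay.FT 1 + Lay.MB ≤ Lay.FT 2
  c7 : Lay.FT 2 + Lay.MB ≤ Lay.rU 0
  c8 : Lay.rU 0 + Lay.R * Lay.N ≤ Lay.rU 1
  c9 : Lay.rU 1 + Lay.R * Lay.N ≤ Lay.rU 2
  c10 : Lay.rU 2 + Lay.R * Lay.N ≤ Lay.X 0
  c11 : Lay.X 0 + Lay.dsz ≤ Lay.X 1
  c12 : Lay.X 1 + Lay.dsz ≤ Lay.X 2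
  c13 : Lay.X 2 + Lay.dsz ≤ cp0
  hM : 1 ≤ Lay.M
  hMw : Lay.M ≤ w
  hw : 4 ≤ w
  hrtk : Lay.r * Lay.tk = Lay.M
  hC : 1 ≤ Lay.C
  hN : 1 ≤ Lay.N
  hR : 1 ≤ Lay.R
  hMB : Lay.MB = 2 ^ Lay.M

/-- The constant tables of a run in memory. [folklore] -/
structure RepData (w : ℕ) (m : ℕ → ℕ) (T : RepTables) (Lay : RepLayout) : Prop where
  hBM : ∀ j i, j < Lay.C → i < Lay.tk → m (Lay.bm + j * Lay.tk + i) = T.BM j i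
  hBM1 : ∀ j i, j < Lay.C → i < Lay.tk → T.BM j i ≤ 1
  hFt : ∀ l a, l < 3 → a < Lay.MB → m (Lay.FT l + a) = T.Ft l a
  hFt1 : ∀ l a, l < 3 → a < Lay.MB → T.Ft l a ≤ 1
  hUc : ∀ l i d, l < 3 → i < Lay.R → d < Lay.N → m (Lay.rU l + i * Lay.N + d) = T.Uc l i d
  hUcw : ∀ l i d, l < 3 → i < Lay.R → d < Lay.N → T.Uc l i d < 2 ^ w

/-- Level `q` of leg `l` as a pure function of the coins. [cite: Pratt2024SCC, §2 (proof of Thm. 1.9)] -/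
def levOf (w : ℕ) (T : RepTables) (Lay : RepLayout) (c v : ℕ → ℕ) (l P : ℕ) : ℕ :=
  levN Lay.N Lay.R Lay.q w (T.Uc l) (xOf T (gOf Lay.M c) Lay v l) Lay.q P 0

/-- **The value of one repetition**: the triple sum of the three level-`q` tables, modulo `2^w`.
[cite: Pratt2024SCC, §2 (proof of Thm. 1.9)] -/
def repV (w : ℕ) (T : RepTables) (Lay : RepLayout) (c v : ℕ → ℕ) : ℕ :=
  (∑ P ∈ range (Lay.R ^ Lay.q), levOf w T Lay c v 0 P * levOf w T Lay c v 1 P * levOf w T Lay c v 2 P) % 2 ^ w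

/-- Step count of one repetition. [folklore] -/
def repTime (Lay : RepLayout) : ℕ :=
  1 + (20 * Lay.M + 8 + (9 + (Lay.M * 8 + 4 + (Lay.r * (Lay.C * (Lay.tk * 8 + 12) + 7) + 4) +
    (Lay.Ntot * (Lay.r * 8 + 33) + 6 + (6 + dpTime Lay.N Lay.R Lay.q + (6 + dpTime Lay.N Lay.R Lay.q +
      (6 + dpTime Lay.N Lay.R Lay.q + (Lay.R ^ Lay.q * 10 + 9))))))))

/-- Fill values are below `16`. [folklore] -/
theorem xOf_le {T : RepTables} {Lay : RepLayout} {g v : ℕ → ℕ} {M : ℕ}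
    (hFt1 : ∀ l a, l < 3 → a < Lay.MB → T.Ft l a ≤ 1) (hMB : Lay.MB = 2 ^ M)
    (hgM : ∀ p, p < M → g p < M) (hginj : ∀ p p', p < M → p' < M → g p = g p' → p = p')
    (hrtk : Lay.r * Lay.tk = M) (hC : 1 ≤ Lay.C) (hBM1 : ∀ j i, j < Lay.C → i < Lay.tk → T.BM j i ≤ 1)
    {l : ℕ} (hl : l < 3) (i : ℕ) : xOf T g Lay v l i ≤ 15 := by
  unfold xOf
  have h1 : T.Ft l (maskOf T.BM g Lay.tk Lay.C Lay.r i) ≤ 1 :=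
    hFt1 l _ hl (by rw [hMB]; exact maskOf_lt hgM hginj hrtk (by omega) hBM1 i)
  have h2 : v (3 * i + l) % 16 < 16 := Nat.mod_lt _ (by norm_num)
  calc _ ≤ 1 * 15 := Nat.mul_le_mul h1 (by omega)
    _ = 15 := by norm_num

set_option linter.unusedSimpArgs false in
set_option maxHeartbeats 4000000 in
/-- **One repetition, specified.** From registers `RepRegs`, a layout `RepSide`, the constant tables
`RepData` and `coins` coin words `cv` at `cp`, `repBody` ends within `repTime` steps with
`81 = orFlag found (repV …)` (the flag or-ed with "the triple sum of this repetition is non-zero"),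
the coin pointer advanced by `coins`, all global registers and all read-only data unchanged.
[cite: Pratt2024SCC, §2 (proof of Thm. 1.9)] -/
theorem repBody_spec {m : ℕ → ℕ} {T : RepTables} {Lay : RepLayout} {cp0 cp found : ℕ} {cv : ℕ → ℕ}
    (hR : RepRegs m Lay cp found) (hS : RepSide w Lay cp0) (hD : RepData w m T Lay)
    (hcp : cp0 ≤ cp) (hcpE : cp + Lay.coins + 1 < 2 ^ w)
    (hcv : ∀ t, t < Lay.coins → m (cp + t) = cv t ∧ cv t < 2 ^ w) (qs : List (List ℕ)) :
    ∃ st', ExecLE w O repBody ⟨m, qs⟩ st' (repTime Lay) ∧ st'.queries = qs ∧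
      st'.mem 81 = orFlag found (repV w T Lay cv (fun t => cv (Lay.M - 1 + t))) ∧
      st'.mem 80 = cp + Lay.coins ∧
      (∀ c, (c < 40 ∨ c = 48 ∨ c = 52 ∨ c = 53) → st'.mem c = m c) ∧
      (∀ c, 100 ≤ c → ¬ (Lay.pa ≤ c ∧ c < Lay.pt + Lay.r * Lay.C) →
        ¬ (Lay.X 0 ≤ c ∧ c < Lay.X 2 + Lay.dsz) → st'.mem c = m c) := by
  obtain ⟨r5, r6, r7, r8, r9, r10, r12, r13, r14, r15, r16, r17, r18, r19, r20, r21, r23, r30, r31,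
    r32, r33, r34, r35, r36, r37, r38, r39, r48, r52, r53, r80, r81, hfound⟩ := hR
  obtain ⟨hpa, c1, c2, c3, c4, c5, c6, c7, c8, c9, c10, c11, c12, c13, hM, hMw, hw, hrtk, hC, hN,
    hRR, hMB⟩ := hS
  obtain ⟨hBM, hBM1, hFt, hFt1, hUc, hUcw⟩ := hD
  -- derived sizes
  have hw2 : w < 2 ^ w := Nat.lt_two_pow_self
  have hNt : Lay.Ntot = Lay.N ^ Lay.q := rfl
  have hds : Lay.dsz = dpSize Lay.R Lay.N Lay.q := rfl
  have hNtot_dsz : Lay.Ntot ≤ Lay.dsz := by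
    have := pow_mul_pow_le_dpSize Lay.R Lay.N Lay.q (Nat.zero_le _)
    rw [pow_zero, one_mul, Nat.sub_zero] at this; exact this
  have hRq_dsz : Lay.R ^ Lay.q ≤ Lay.dsz := by
    have := pow_mul_pow_le_dpSize Lay.R Lay.N Lay.q le_rfl
    rw [Nat.sub_self, pow_zero, mul_one] at this; exact this
  have hNtot1 : 1 ≤ Lay.Ntot := Nat.pow_pos hN
  have hLB : ∀ l, Lay.X l ≤ Lay.LB l ∧ Lay.LB l + Lay.R ^ Lay.q ≤ Lay.X l + Lay.dsz := fun l => by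
    constructor
    · have := levelBase_mono (Lay.X l) Lay.R Lay.N Lay.q (Nat.zero_le Lay.q)
      rw [levelBase_zero] at this; exact this
    · have := levelBase_succ (Lay.X l) Lay.R Lay.N Lay.q Lay.q
      rw [Nat.sub_self, pow_zero, mul_one, levelBase_top] at this
      show levelBase (Lay.X l) Lay.R Lay.N Lay.q Lay.q + Lay.R ^ Lay.q ≤ Lay.X l + dpSize Lay.R Lay.N Lay.q
      omega
  obtain ⟨hLB0a, hLB0b⟩ := hLB 0
  obtain ⟨hLB1a, hLB1b⟩ := hLB 1
  obtain ⟨hLB2a, hLB2b⟩ := hLB 2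
  have hr1 : 1 ≤ Lay.r := Nat.pos_of_ne_zero fun h => by rw [h, zero_mul] at hrtk; omega
  have htk1 : 1 ≤ Lay.tk := Nat.pos_of_ne_zero fun h => by rw [h, mul_zero] at hrtk; omega
  have hrM : Lay.r ≤ Lay.M := hrtk ▸ Nat.le_mul_of_pos_right _ htk1
  have htkM : Lay.tk ≤ Lay.M := hrtk ▸ Nat.le_mul_of_pos_left _ hr1
  have hCr : Lay.C ≤ Lay.r * Lay.C := Nat.le_mul_of_pos_left _ hr1
  have h2M : 2 ^ Lay.M ≤ 2 ^ w := Nat.pow_le_pow_right (by norm_num) hMw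
  have hFTl : ∀ l, l < 3 → Lay.FT 0 ≤ Lay.FT l ∧ Lay.FT l + Lay.MB ≤ Lay.rU 0 := by
    intro l hl; interval_cases l <;> constructor <;> omega
  have hXl : ∀ l, l < 3 → Lay.X 0 ≤ Lay.X l ∧ Lay.X l + Lay.dsz ≤ cp0 := by
    intro l hl; interval_cases l <;> constructor <;> omega
  have hrUl : ∀ l, l < 3 → Lay.rU 0 ≤ Lay.rU l ∧ Lay.rU l + Lay.R * Lay.N ≤ Lay.X 0 := by
    intro l hl; interval_cases l <;> constructor <;> omega
  have hrow : ∀ {i R N : ℕ}, i < R → i * N + N ≤ R * N := fun {i R N} hi => by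
    have := Nat.mul_le_mul_right N hi; rw [Nat.succ_mul] at this; exact this
  unfold RepLayout.coins at hcpE hcv ⊢
  -- the values are small
  have hxle : ∀ l, l < 3 → ∀ i, xOf T (gOf Lay.M cv) Lay (fun t => cv (Lay.M - 1 + t)) l i ≤ 15 :=
    fun l hl i => xOf_le hFt1 hMB (fun p hp => gOf_lt cv hp) (fun p p' hp hp' h => gOf_inj cv hp hp' h)
      hrtk hC hBM1 hl i
  -- Step 0: the coin pointer to `40`
  obtain ⟨st₁, hex₁, hq₁, g40, k₁⟩ : ∃ st', Exec w O (block preFY) ⟨m, qs⟩ st' 1 ∧ (st'.queries = qs ∧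
      st'.mem 40 = cp ∧ ∀ c, c ≠ 40 → st'.mem c = m c) := by
    refine Exec.block_of_fwd preFY qs fun Rf hRf => ?_
    unfold preFY at hRf
    have htmp := execOps_cons_fwd hRf; clear hRf; obtain ⟨v1, hv1, hRf⟩ := htmp
    simp -failIfUnchanged (disch := omega) only [Operand.write, Operand.read,
      Function.update_self, Function.update_of_ne, BinOp.eval_add_mod', BinOp.eval_mul_mod',
      Nat.mod_eq_of_lt, BinOp.eval_sub_of_le, BinOp.eval_lt, Nat.add_zero, r80] at hv1 hRf
    subst v1
    simp only [execOps_nil] at hRf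
    subst hRf
    refine ⟨rfl, ?_, fun c hc => ?_⟩ <;> dsimp only <;>
      simp (disch := omega) only [Function.update_of_ne, Function.update_self]
  obtain ⟨m₁, qq₁⟩ := st₁
  simp only at hq₁ g40 k₁
  subst qq₁
  -- Step 1: the shuffle
  obtain ⟨st₂, hex₂, hq₂, f40, hg, k₂⟩ := fisherYates_plain (w := w) (O := O) (m := m₁) (A := Lay.pa)
    (N := Lay.M) (C := cp) cv (by rw [k₁ 15 (by norm_num)]; exact r15)
    (by rw [k₁ 6 (by norm_num)]; exact r6) g40 hpa (by omega) hM (Or.inl (by omega)) (by omega)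
    (by omega) (fun t ht => by rw [k₁ _ (by omega)]; exact hcv t (by omega)) qs
  obtain ⟨m₂, qq₂⟩ := st₂
  simp only at hq₂ f40 hg k₂
  subst qq₂
  have K₂ : ∀ a, ¬ (40 ≤ a ∧ a ≤ 47) → ¬ (Lay.pa ≤ a ∧ a < Lay.pa + Lay.M) → m₂ a = m a :=
    fun a h1 h2 => (k₂ a h1 h2).trans (k₁ a (by omega))
  -- Step 2: restore the registers
  have g23 : m₂ 23 = Lay.FT 1 := by rw [K₂ 23 (by omega) (by omega)]; exact r23
  have g19 : m₂ 19 = Lay.FT 2 := by rw [K₂ 19 (by omega) (by omega)]; exact r19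
  have g16 : m₂ 16 = Lay.X 0 := by rw [K₂ 16 (by omega) (by omega)]; exact r16
  have g17 : m₂ 17 = Lay.X 1 := by rw [K₂ 17 (by omega) (by omega)]; exact r17
  have g18 : m₂ 18 = Lay.X 2 := by rw [K₂ 18 (by omega) (by omega)]; exact r18
  have g10 : m₂ 10 = Lay.R ^ Lay.q := by rw [K₂ 10 (by omega) (by omega)]; exact r10
  have g20 : m₂ 20 = Lay.LB 0 := by rw [K₂ 20 (by omega) (by omega)]; exact r20
  have g21 : m₂ 21 = Lay.LB 1 := by rw [K₂ 21 (by omega) (by omega)]; exact r21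
  obtain ⟨st₃, hex₃, hP₃⟩ : ∃ st', Exec w O (block restore) ⟨m₂, qs⟩ st' 9 ∧
      (st'.queries = qs ∧ st'.mem 80 = cp + (Lay.M - 1) ∧ st'.mem 40 = Lay.FT 1 ∧
        st'.mem 41 = Lay.FT 2 ∧ st'.mem 42 = Lay.X 0 ∧ st'.mem 43 = Lay.X 1 ∧ st'.mem 44 = Lay.X 2 ∧
        st'.mem 45 = Lay.R ^ Lay.q ∧ st'.mem 46 = Lay.LB 0 ∧ st'.mem 47 = Lay.LB 1 ∧
        ∀ c, c ≠ 80 → ¬ (40 ≤ c ∧ c ≤ 47) → st'.mem c = m₂ c) := by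
    refine Exec.block_of_fwd restore qs fun Rf hRf => ?_
    unfold restore at hRf
    have htmp := execOps_cons_fwd hRf; clear hRf; obtain ⟨v1, hv1, hRf⟩ := htmp
    simp -failIfUnchanged (disch := omega) only [Operand.write, Operand.read,
      Function.update_self, Function.update_of_ne, BinOp.eval_add_mod', BinOp.eval_mul_mod',
      Nat.mod_eq_of_lt, BinOp.eval_sub_of_le, BinOp.eval_lt, Nat.add_zero, f40] at hv1 hRf
    subst v1
    have htmp := execOps_cons_fwd hRf; clear hRf; obtain ⟨v2, hv2, hRf⟩ := htmp
    simp -failIfUnchanged (disch := omega) only [Operand.write, Operand.read,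
      Function.update_self, Function.update_of_ne, BinOp.eval_add_mod', BinOp.eval_mul_mod',
      Nat.mod_eq_of_lt, BinOp.eval_sub_of_le, BinOp.eval_lt, Nat.add_zero, g23] at hv2 hRf
    subst v2
    have htmp := execOps_cons_fwd hRf; clear hRf; obtain ⟨v3, hv3, hRf⟩ := htmp
    simp -failIfUnchanged (disch := omega) only [Operand.write, Operand.read,
      Function.update_self, Function.update_of_ne, BinOp.eval_add_mod', BinOp.eval_mul_mod',
      Nat.mod_eq_of_lt, BinOp.eval_sub_of_le, BinOp.eval_lt, Nat.add_zero, g19] at hv3 hRf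
    subst v3
    have htmp := execOps_cons_fwd hRf; clear hRf; obtain ⟨v4, hv4, hRf⟩ := htmp
    simp -failIfUnchanged (disch := omega) only [Operand.write, Operand.read,
      Function.update_self, Function.update_of_ne, BinOp.eval_add_mod', BinOp.eval_mul_mod',
      Nat.mod_eq_of_lt, BinOp.eval_sub_of_le, BinOp.eval_lt, Nat.add_zero, g16] at hv4 hRf
    subst v4
    have htmp := execOps_cons_fwd hRf; clear hRf; obtain ⟨v5, hv5, hRf⟩ := htmp
    simp -failIfUnchanged (disch := omega) only [Operand.write, Operand.read,
      Function.update_self, Function.update_of_ne, BinOp.eval_add_mod', BinOp.eval_mul_mod',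
      Nat.mod_eq_of_lt, BinOp.eval_sub_of_le, BinOp.eval_lt, Nat.add_zero, g17] at hv5 hRf
    subst v5
    have htmp := execOps_cons_fwd hRf; clear hRf; obtain ⟨v6, hv6, hRf⟩ := htmp
    simp -failIfUnchanged (disch := omega) only [Operand.write, Operand.read,
      Function.update_self, Function.update_of_ne, BinOp.eval_add_mod', BinOp.eval_mul_mod',
      Nat.mod_eq_of_lt, BinOp.eval_sub_of_le, BinOp.eval_lt, Nat.add_zero, g18] at hv6 hRf
    subst v6
    have htmp := execOps_cons_fwd hRf; clear hRf; obtain ⟨v7, hv7, hRf⟩ := htmp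
    simp -failIfUnchanged (disch := omega) only [Operand.write, Operand.read,
      Function.update_self, Function.update_of_ne, BinOp.eval_add_mod', BinOp.eval_mul_mod',
      Nat.mod_eq_of_lt, BinOp.eval_sub_of_le, BinOp.eval_lt, Nat.add_zero, g10] at hv7 hRf
    subst v7
    have htmp := execOps_cons_fwd hRf; clear hRf; obtain ⟨v8, hv8, hRf⟩ := htmp
    simp -failIfUnchanged (disch := omega) only [Operand.write, Operand.read,
      Function.update_self, Function.update_of_ne, BinOp.eval_add_mod', BinOp.eval_mul_mod',
      Nat.mod_eq_of_lt, BinOp.eval_sub_of_le, BinOp.eval_lt, Nat.add_zero, g20] at hv8 hRf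
    subst v8
    have htmp := execOps_cons_fwd hRf; clear hRf; obtain ⟨v9, hv9, hRf⟩ := htmp
    simp -failIfUnchanged (disch := omega) only [Operand.write, Operand.read,
      Function.update_self, Function.update_of_ne, BinOp.eval_add_mod', BinOp.eval_mul_mod',
      Nat.mod_eq_of_lt, BinOp.eval_sub_of_le, BinOp.eval_lt, Nat.add_zero, g21] at hv9 hRf
    subst v9
    simp only [execOps_nil] at hRf
    subst hRf
    refine ⟨rfl, ?_, ?_, ?_, ?_, ?_, ?_, ?_, ?_, ?_, fun c hc hc' => ?_⟩ <;> dsimp only <;>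
      simp (disch := omega) only [Function.update_of_ne, Function.update_self]
  obtain ⟨hq₃, e80, e40, e41, e42, e43, e44, e45, e46, e47, k₃⟩ := hP₃
  obtain ⟨m₃, qq₃⟩ := st₃
  simp only at hq₃ e80 e40 e41 e42 e43 e44 e45 e46 e47 k₃
  subst qq₃
  have K₃ : ∀ a, ¬ (40 ≤ a ∧ a ≤ 47) → a ≠ 80 → ¬ (Lay.pa ≤ a ∧ a < Lay.pa + Lay.M) → m₃ a = m a :=
    fun a h1 h2 h3 => (k₃ a h2 h1).trans (K₂ a h1 h3)
  -- Step 3: the bit table and the pattern masks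
  obtain ⟨st₄, hex₄, hq₄, hPT, hPTlt, _, k₄⟩ := tables_step (w := w) (O := O) (m := m₃)
    (g := gOf Lay.M cv) (BM := T.BM)
    (by rw [K₃ 30 (by omega) (by omega) (by omega)]; exact r30)
    (by rw [K₃ 31 (by omega) (by omega) (by omega)]; exact r31)
    (by rw [K₃ 32 (by omega) (by omega) (by omega)]; exact r32)
    (by rw [K₃ 33 (by omega) (by omega) (by omega)]; exact r33)
    (by rw [K₃ 34 (by omega) (by omega) (by omega)]; exact r34)
    (by rw [K₃ 35 (by omega) (by omega) (by omega)]; exact r35)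
    (by rw [K₃ 36 (by omega) (by omega) (by omega)]; exact r36)
    (by rw [K₃ 37 (by omega) (by omega) (by omega)]; exact r37)
    hpa (by omega) (by omega) (by omega) (by omega) (by omega) (by omega) (by omega)
    (by omega) (by omega) (by omega) hMw hrtk (Or.inl c1) (Or.inr c2) (Or.inl c3) (Or.inl (by omega))
    (fun p hp => by
      rw [k₃ _ (by omega) (by omega), hg p hp, gOf, dif_pos hp])
    (fun p hp => gOf_lt cv hp) (fun p p' hp hp' h => gOf_inj cv hp hp' h)
    (fun j i hj hi => by
      have := hrow (N := Lay.tk) hj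
      rw [K₃ _ (by omega) (by omega) (by omega)]; exact hBM j i hj hi) hBM1 qs
  obtain ⟨m₄, qq₄⟩ := st₄
  simp only at hq₄ hPT k₄
  subst qq₄
  have L₄ : ∀ a, (a < 40 ∨ a = 48 ∨ a = 52 ∨ a = 53 ∨ a = 81) → m₄ a = m a := fun a ha => by
    rw [k₄ a (by omega) (by omega) (by omega)]; exact K₃ a (by omega) (by omega) (by omega)
  have D₄ : ∀ a, 100 ≤ a → ¬ (Lay.pa ≤ a ∧ a < Lay.pt + Lay.r * Lay.C) → m₄ a = m a := fun a ha hna => by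
    rw [k₄ a (by omega) (by omega) (by omega)]; exact K₃ a (by omega) (by omega) (by omega)
  -- Step 4: fill the three vectors
  obtain ⟨st₅, hex₅, hq₅, f80, hXv, k₅⟩ := fill_step (w := w) (O := O) (m := m₄) (T := T) (Lay := Lay)
    (g := gOf Lay.M cv) (v := fun t => cv (Lay.M - 1 + t)) (M := Lay.M) (cp := cp + (Lay.M - 1))
    (by rw [k₄ 33 (by omega) (by omega) (by omega), K₃ 33 (by omega) (by omega) (by omega)]; exact r33)
    (by rw [k₄ 35 (by omega) (by omega) (by omega), K₃ 35 (by omega) (by omega) (by omega)]; exact r35)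
    (by rw [k₄ 36 (by omega) (by omega) (by omega), K₃ 36 (by omega) (by omega) (by omega)]; exact r36)
    (by rw [k₄ 38 (by omega) (by omega) (by omega), K₃ 38 (by omega) (by omega) (by omega)]; exact r38)
    (by rw [k₄ 39 (by omega) (by omega) (by omega), K₃ 39 (by omega) (by omega) (by omega)]; exact r39)
    (by rw [k₄ 40 (by omega) (by omega) (by omega)]; exact e40)
    (by rw [k₄ 41 (by omega) (by omega) (by omega)]; exact e41)
    (by rw [k₄ 42 (by omega) (by omega) (by omega)]; exact e42)
    (by rw [k₄ 43 (by omega) (by omega) (by omega)]; exact e43)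
    (by rw [k₄ 44 (by omega) (by omega) (by omega)]; exact e44)
    (by rw [k₄ 80 (by omega) (by omega) (by omega)]; exact e80)
    (by omega) hC (by omega) (by omega)
    (fun l hl => by have := hFTl l hl; constructor <;> omega)
    (fun l hl => by have := hXl l hl; constructor <;> omega)
    (by omega) (by omega) hw
    (fun l hl => by have := hXl l hl; exact Or.inr (by omega))
    (fun l l' hl hl' => by have := hXl l hl; have := hFTl l' hl'; exact Or.inr (by omega))
    (fun l hl => by have := hXl l hl; exact Or.inl (by omega))
    (fun l l' hl hl' hll => by
      interval_cases l <;> interval_cases l' <;>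
        first | exact absurd rfl hll | exact Or.inl (by omega) | exact Or.inr (by omega))
    hMB (fun p hp => gOf_lt cv hp) (fun p p' hp hp' h => gOf_inj cv hp hp' h) hrtk hBM1 hPT
    (fun l a hl ha => by
      have := hFTl l hl
      rw [D₄ _ (by omega) (by omega)]; exact hFt l a hl ha)
    hFt1
    (fun t ht => by
      rw [D₄ _ (by omega) (by omega), show cp + (Lay.M - 1) + t = cp + (Lay.M - 1 + t) by omega]
      exact hcv _ (by omega)) qs
  obtain ⟨m₅, qq₅⟩ := st₅
  simp only at hq₅ f80 hXv k₅
  subst qq₅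
  have L₅ : ∀ a, (a < 40 ∨ a = 48 ∨ a = 52 ∨ a = 53 ∨ a = 81) → m₅ a = m a := fun a ha => by
    have h1 := (hXl 0 (by norm_num)).1
    rw [k₅ a (by omega) (by omega) (by omega) (by omega) (by omega)]; exact L₄ a ha
  have D₅ : ∀ a, 100 ≤ a → ¬ (Lay.pa ≤ a ∧ a < Lay.pt + Lay.r * Lay.C) →
      ¬ (Lay.X 0 ≤ a ∧ a < Lay.X 2 + Lay.dsz) → m₅ a = m a := fun a ha hna hnx => by
    rw [k₅ a (by omega) (by omega) (by omega) (by omega) (by omega)]; exact D₄ a ha hna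
  have E₅ : ∀ a, 41 ≤ a → a ≤ 48 → m₅ a = m₄ a := fun a h1 h2 => by
    have h1 := (hXl 0 (by norm_num)).1
    exact k₅ a (by omega) (by omega) (by omega) (by omega) (by omega)
  have e45' : m₄ 45 = Lay.R ^ Lay.q := by rw [k₄ 45 (by omega) (by omega) (by omega)]; exact e45
  have e46' : m₄ 46 = Lay.LB 0 := by rw [k₄ 46 (by omega) (by omega) (by omega)]; exact e46
  have e47' : m₄ 47 = Lay.LB 1 := by rw [k₄ 47 (by omega) (by omega) (by omega)]; exact e47
  have e48' : m₄ 48 = Lay.LB 2 := L₄ 48 (by omega) ▸ r48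
  -- Step 5–7: the three level computations
  have hUcm : ∀ l i d, l < 3 → i < Lay.R → d < Lay.N → m₅ (Lay.rU l + i * Lay.N + d) = T.Uc l i d :=
    fun l i d hl hi hd => by
      have := hrUl l hl; have := hrow (N := Lay.N) hi; have := (hXl l hl).1
      rw [D₅ _ (by omega) (by omega) (by omega)]; exact hUc l i d hl hi hd
  have hLS : ∀ l, l < 3 → ∀ mm : ℕ → ℕ, (∀ i d, i < Lay.R → d < Lay.N →
      mm (Lay.rU l + i * Lay.N + d) = T.Uc l i d) →
      (∀ A, A < Lay.Ntot → mm (Lay.X l + A) = xOf T (gOf Lay.M cv) Lay (fun t => cv (Lay.M - 1 + t)) l A) →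
      LSide w mm (Lay.rU l) (Lay.X l) Lay.N Lay.R Lay.q := fun l hl mm hU hx => by
    have hA1 := hrUl l hl; have hA2 := hXl l hl; have hA3 := hFTl 0 (by norm_num)
    refine ⟨by omega, by omega, hN, hRR, ?_, fun i d hi hd => ?_, fun A hA => ?_⟩
    · rw [levelBase_top]; show Lay.X l + Lay.dsz < 2 ^ w; omega
    · rw [hU i d hi hd]; exact hUcw l i d hl hi hd
    · rw [hx A hA]; have := hxle l hl A; omega
  -- leg 0
  obtain ⟨st₆, hex₆, hq₆, hd₀, k₆⟩ := dp_step (w := w) (O := O) (m := m₅) (l := 0) (rU := Lay.rU 0)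
    (X := Lay.X 0) (N := Lay.N) (R := Lay.R) (q := Lay.q) (by norm_num)
    ((L₅ 12 (by omega)).trans r12) ((L₅ 5 (by omega)).trans r5) ((L₅ 16 (by omega)).trans r16)
    ((L₅ 8 (by omega)).trans r8) ((L₅ 7 (by omega)).trans r7) ((L₅ 9 (by omega)).trans r9)
    ((L₅ 52 (by omega)).trans r52) ((L₅ 53 (by omega)).trans r53)
    (hLS 0 (by norm_num) m₅ (fun i d hi hd => hUcm 0 i d (by norm_num) hi hd)
      (fun A hA => hXv 0 A (by norm_num) hA)) qs
  obtain ⟨m₆, qq₆⟩ := st₆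
  simp only at hq₆ hd₀ k₆
  subst qq₆
  have lev₀ : ∀ P, P < Lay.R ^ Lay.q → m₆ (Lay.LB 0 + P) = levOf w T Lay cv (fun t => cv (Lay.M - 1 + t)) 0 P :=
    fun P hP => (hd₀ P hP).trans (levN_congr hRR (fun i d hi hd => hUcm 0 i d (by norm_num) hi hd)
      (fun A hA => hXv 0 A (by norm_num) hA) Lay.q le_rfl P 0 (by simp))
  have F₆ : ∀ a, ¬ (Lay.X 0 + Lay.Ntot ≤ a ∧ a < Lay.X 0 + Lay.dsz) → a ≠ 50 → ¬ (55 ≤ a ∧ a ≤ 72) →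
      m₆ a = m₅ a := fun a h1 h2 h3 => k₆ a h2 h3 h1
  -- leg 1
  have x100 := (hXl 0 (by norm_num)).1
  obtain ⟨st₇, hex₇, hq₇, hd₁, k₇⟩ := dp_step (w := w) (O := O) (m := m₆) (l := 1) (rU := Lay.rU 1)
    (X := Lay.X 1) (N := Lay.N) (R := Lay.R) (q := Lay.q) (by norm_num)
    ((F₆ 13 (by omega) (by omega) (by omega)).trans ((L₅ 13 (by omega)).trans r13))
    ((F₆ 5 (by omega) (by omega) (by omega)).trans ((L₅ 5 (by omega)).trans r5))
    ((F₆ 17 (by omega) (by omega) (by omega)).trans ((L₅ 17 (by omega)).trans r17))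
    ((F₆ 8 (by omega) (by omega) (by omega)).trans ((L₅ 8 (by omega)).trans r8))
    ((F₆ 7 (by omega) (by omega) (by omega)).trans ((L₅ 7 (by omega)).trans r7))
    ((F₆ 9 (by omega) (by omega) (by omega)).trans ((L₅ 9 (by omega)).trans r9))
    ((F₆ 52 (by omega) (by omega) (by omega)).trans ((L₅ 52 (by omega)).trans r52))
    ((F₆ 53 (by omega) (by omega) (by omega)).trans ((L₅ 53 (by omega)).trans r53))
    (hLS 1 (by norm_num) m₆
      (fun i d hi hd => by
        have := hrow (N := Lay.N) hi
        rw [F₆ _ (by omega) (by omega) (by omega)]; exact hUcm 1 i d (by norm_num) hi hd)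
      (fun A hA => by rw [F₆ _ (by omega) (by omega) (by omega)]; exact hXv 1 A (by norm_num) hA)) qs
  obtain ⟨m₇, qq₇⟩ := st₇
  simp only at hq₇ hd₁ k₇
  subst qq₇
  have lev₁ : ∀ P, P < Lay.R ^ Lay.q → m₇ (Lay.LB 1 + P) = levOf w T Lay cv (fun t => cv (Lay.M - 1 + t)) 1 P :=
    fun P hP => (hd₁ P hP).trans (levN_congr hRR
      (fun i d hi hd => by
        have := hrow (N := Lay.N) hi
        rw [F₆ _ (by omega) (by omega) (by omega)]; exact hUcm 1 i d (by norm_num) hi hd)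
      (fun A hA => by rw [F₆ _ (by omega) (by omega) (by omega)]; exact hXv 1 A (by norm_num) hA)
      Lay.q le_rfl P 0 (by simp))
  have F₇ : ∀ a, ¬ (Lay.X 1 + Lay.Ntot ≤ a ∧ a < Lay.X 1 + Lay.dsz) → a ≠ 50 → ¬ (55 ≤ a ∧ a ≤ 72) →
      m₇ a = m₆ a := fun a h1 h2 h3 => k₇ a h2 h3 h1
  -- leg 2
  obtain ⟨st₈, hex₈, hq₈, hd₂, k₈⟩ := dp_step (w := w) (O := O) (m := m₇) (l := 2) (rU := Lay.rU 2)
    (X := Lay.X 2) (N := Lay.N) (R := Lay.R) (q := Lay.q) (by norm_num)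
    ((F₇ 14 (by omega) (by omega) (by omega)).trans ((F₆ 14 (by omega) (by omega) (by omega)).trans ((L₅ 14 (by omega)).trans r14)))
    ((F₇ 5 (by omega) (by omega) (by omega)).trans ((F₆ 5 (by omega) (by omega) (by omega)).trans ((L₅ 5 (by omega)).trans r5)))
    ((F₇ 18 (by omega) (by omega) (by omega)).trans ((F₆ 18 (by omega) (by omega) (by omega)).trans ((L₅ 18 (by omega)).trans r18)))
    ((F₇ 8 (by omega) (by omega) (by omega)).trans ((F₆ 8 (by omega) (by omega) (by omega)).trans ((L₅ 8 (by omega)).trans r8)))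
    ((F₇ 7 (by omega) (by omega) (by omega)).trans ((F₆ 7 (by omega) (by omega) (by omega)).trans ((L₅ 7 (by omega)).trans r7)))
    ((F₇ 9 (by omega) (by omega) (by omega)).trans ((F₆ 9 (by omega) (by omega) (by omega)).trans ((L₅ 9 (by omega)).trans r9)))
    ((F₇ 52 (by omega) (by omega) (by omega)).trans ((F₆ 52 (by omega) (by omega) (by omega)).trans ((L₅ 52 (by omega)).trans r52)))
    ((F₇ 53 (by omega) (by omega) (by omega)).trans ((F₆ 53 (by omega) (by omega) (by omega)).trans ((L₅ 53 (by omega)).trans r53)))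
    (hLS 2 (by norm_num) m₇
      (fun i d hi hd => by
        have := hrow (N := Lay.N) hi
        rw [F₇ _ (by omega) (by omega) (by omega), F₆ _ (by omega) (by omega) (by omega)]; exact hUcm 2 i d (by norm_num) hi hd)
      (fun A hA => by
        rw [F₇ _ (by omega) (by omega) (by omega), F₆ _ (by omega) (by omega) (by omega)]; exact hXv 2 A (by norm_num) hA)) qs
  obtain ⟨m₈, qq₈⟩ := st₈
  simp only at hq₈ hd₂ k₈
  subst qq₈
  have lev₂ : ∀ P, P < Lay.R ^ Lay.q → m₈ (Lay.LB 2 + P) = levOf w T Lay cv (fun t => cv (Lay.M - 1 + t)) 2 P :=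
    fun P hP => (hd₂ P hP).trans (levN_congr hRR
      (fun i d hi hd => by
        have := hrow (N := Lay.N) hi
        rw [F₇ _ (by omega) (by omega) (by omega), F₆ _ (by omega) (by omega) (by omega)]; exact hUcm 2 i d (by norm_num) hi hd)
      (fun A hA => by
        rw [F₇ _ (by omega) (by omega) (by omega), F₆ _ (by omega) (by omega) (by omega)]; exact hXv 2 A (by norm_num) hA)
      Lay.q le_rfl P 0 (by simp))
  have F₈ : ∀ a, ¬ (Lay.X 2 + Lay.Ntot ≤ a ∧ a < Lay.X 2 + Lay.dsz) → a ≠ 50 → ¬ (55 ≤ a ∧ a ≤ 72) →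
      m₈ a = m₇ a := fun a h1 h2 h3 => k₈ a h2 h3 h1
  have lev₀' : ∀ P, P < Lay.R ^ Lay.q → m₈ (Lay.LB 0 + P) = levOf w T Lay cv (fun t => cv (Lay.M - 1 + t)) 0 P :=
    fun P hP => by rw [F₈ _ (by omega) (by omega) (by omega), F₇ _ (by omega) (by omega) (by omega)]; exact lev₀ P hP
  have lev₁' : ∀ P, P < Lay.R ^ Lay.q → m₈ (Lay.LB 1 + P) = levOf w T Lay cv (fun t => cv (Lay.M - 1 + t)) 1 P :=
    fun P hP => by rw [F₈ _ (by omega) (by omega) (by omega)]; exact lev₁ P hP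
  have reg : ∀ a, a ≠ 50 → ¬ (55 ≤ a ∧ a ≤ 72) → a < 100 → m₈ a = m₅ a := fun a h1 h2 h3 => by
    rw [F₈ a (by omega) h1 h2, F₇ a (by omega) h1 h2, F₆ a (by omega) h1 h2]
  -- Step 8: the triple sum
  obtain ⟨st₉, hex₉, hq₉, _, f81, k₉⟩ := tripleProg_spec (w := w) (O := O) (m := m₈) (X := Lay.LB 0)
    (Y := Lay.LB 1) (Z := Lay.LB 2) (SP := Lay.R ^ Lay.q) (found := found)
    ((reg 45 (by omega) (by omega) (by omega)).trans ((E₅ 45 (by omega) (by omega)).trans e45'))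
    ((reg 46 (by omega) (by omega) (by omega)).trans ((E₅ 46 (by omega) (by omega)).trans e46'))
    ((reg 47 (by omega) (by omega) (by omega)).trans ((E₅ 47 (by omega) (by omega)).trans e47'))
    ((reg 48 (by omega) (by omega) (by omega)).trans ((E₅ 48 (by omega) (by omega)).trans e48'))
    ((reg 81 (by omega) (by omega) (by omega)).trans ((L₅ 81 (by omega)).trans r81)) hfound
    (by omega) (by omega) (by omega) (by omega) (by omega) (by omega) (by omega) (by omega)
    (fun P hP => by
      rw [lev₀' P hP]
      exact levN_lt (fun A => by have := hxle 0 (by norm_num) A; omega) _ _ _) qs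
  obtain ⟨m₉, qq₉⟩ := st₉
  simp only at hq₉ f81 k₉
  subst qq₉
  have hV : tripleSum w m₈ (Lay.LB 0) (Lay.LB 1) (Lay.LB 2) (Lay.R ^ Lay.q) =
      repV w T Lay cv (fun t => cv (Lay.M - 1 + t)) := by
    unfold tripleSum triplePart repV
    congr 1
    refine sum_congr rfl fun P hP => ?_
    rw [mem_range] at hP
    rw [lev₀' P hP, lev₁' P hP, lev₂ P hP]
  refine ⟨⟨m₉, qs⟩, ?_, rfl, by show m₉ 81 = _; rw [f81, hV], ?_, fun c hc => ?_, fun c hc hna hnx => ?_⟩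
  · unfold repBody repTime
    exact hex₁.execLE.seqs_cons (hex₂.seqs_cons (hex₃.execLE.seqs_cons (hex₄.seqs_cons
      (hex₅.seqs_cons (hex₆.seqs_cons (hex₇.seqs_cons (hex₈.seqs_cons (ExecLE.seqs_one hex₉))))))))
  · show m₉ 80 = _
    rw [k₉ 80 (by omega), reg 80 (by omega) (by omega) (by omega), f80]; omega
  · show m₉ c = m c
    rw [k₉ c (by omega), reg c (by omega) (by omega) (by omega)]; exact L₅ c (by omega)
  · show m₉ c = m c
    have := (hXl 2 (by norm_num)).1
    rw [k₉ c (by omega), F₈ c (by omega) (by omega) (by omega), F₇ c (by omega) (by omega) (by omega), F₆ c (by omega) (by omega) (by omega)]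
    exact D₅ c hc hna hnx

end SProg

end Literature.Computability.Cryptography.WordRAM
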